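import Literature.Probability.RandomPlanarGeometry.RectangleConformalMap
import HarnessLib

/-!
# Loops tracing the frontier of a rectangle: position of the four lateral points of height `∓h`

Topic `Literature/Probability/RandomPlanarGeometry` (support for Schramm–Smirnov's perturbation
argument, *On the scaling limits of planar percolation*, Ann. Probab. 39 (2011), §5, proof of
Lemma 5.1: quads are compared with the images `Q̂₀([x₀, x₁] × [y₀, y₁])` of slightly perturbed
rectangles; to SMOOTH such a perturbed quad one replaces it by a level curve of a Riemann map and
marks the level curve at the boundary-correspondence preimages of four lateral points — file
`TameLevelRectangle.lean`).  The present file is the elementary real-variable topology of that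
marking, for the symmetric rectangle `Q = (-a, a) × (-b, b)` (`symRect a b`) and a height
`0 < h < b`:

* `RectLoop.forall_lt_or_forall_gt` — a continuous real function on a preconnected set of reals
  that omits the value `ℓ` stays on one side of `ℓ` (intermediate value theorem);
* `RectLoop.re_eq_of_mem_frontier`, `RectLoop.eq_or_eq_of_im_eq` — on `∂Q` the points of a height
  `ℓ ∈ (-b, b)` are the two lateral points `(∓a, ℓ)`;
* for a loop `Ψ : ℝ → ℂ` (continuous, `Ψ 1 = Ψ 0`, injective on `[0, 1)`, `Ψ([0,1)) = ∂Q`) starting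
  at a lateral point of height `-h` and passing the other one at the parameter `t₁ ∈ (0, 1)`:
  the **orientation dichotomy** `RectLoop.forall_Ioo_im_lt_or` (one of the two open arcs `(0, t₁)`,
  `(t₁, 1)` runs strictly below the height `-h`), and, under the orientation hypothesis "the arc
  `(0, t₁)` runs below `-h`", `RectLoop.forall_Ioo_lt_im` (the other arc runs above `-h`),
  `RectLoop.lt_of_im_eq` (the two points of height `h` come after `t₁`) and the summary
  `RectLoop.arcs_position`: if `u < v` are their parameters then `Ψ[0, t₁]` has height `≤ -h`,
  `Ψ[t₁, 1]` height `≥ -h`, `Ψ[u, v]` height `≥ h`, and `Ψ[0, u]`, `Ψ[v, 1]` height `≤ h`.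

Everything is proved; only the intermediate value theorem on intervals
(`IsPreconnected.intermediate_value`) and the description of `frontier (symRect a b)`
(`mem_frontier_symRect`) are used.  Not here: anything complex-analytic (see
`TameLevelRectangle.lean`), and the cyclic order of four points on a general Jordan curve.

## References

* O. Schramm, S. Smirnov, *On the scaling limits of planar percolation*, Ann. Probab. 39 (2011)
  1768–1814, §5 (proof of Lemma 5.1). [SchrammSmirnov2011]
-/

noncomputable section

open Set Filter Topology Complex Metric

namespace Literature.Probability.RandomPlanarGeometry

namespace RectLoop

variable {a b : ℝ}

/-- A continuous real function on a preconnected set that never takes the value `ℓ` stays on one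
side of `ℓ` (intermediate value theorem). [folklore] -/
theorem forall_lt_or_forall_gt {f : ℝ → ℝ} {J : Set ℝ} (hJ : IsPreconnected J)
    (hf : ContinuousOn f J) {ℓ : ℝ} (hne : ∀ t ∈ J, f t ≠ ℓ) :
    (∀ t ∈ J, f t < ℓ) ∨ (∀ t ∈ J, ℓ < f t) := by
  by_contra hcon
  push Not at hcon
  obtain ⟨⟨t, ht, hft⟩, ⟨t', ht', hft'⟩⟩ := hcon
  have h1 : ℓ < f t := lt_of_le_of_ne hft (hne t ht).symm
  have h2 : f t' < ℓ := lt_of_le_of_ne hft' (hne t' ht')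
  obtain ⟨c, hc, hfc⟩ := hJ.intermediate_value ht' ht hf ⟨h2.le, h1.le⟩
  exact hne c hc hfc

/-- A frontier point of the rectangle `(-a, a) × (-b, b)` of height strictly between `-b` and `b`
lies on a lateral side. [folklore] -/
theorem re_eq_of_mem_frontier (ha : 0 < a) (hb : 0 < b) {z : ℂ}
    (hz : z ∈ frontier (symRect a b)) (h1 : -b < z.im) (h2 : z.im < b) :
    z.re = -a ∨ z.re = a := by
  rcases (mem_frontier_symRect ha hb).1 hz with ⟨-, h | h⟩ | ⟨h, -⟩
  · exact absurd h (ne_of_gt h1)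
  · exact absurd h (ne_of_lt h2)
  · exact h

/-- On the frontier of the rectangle there are only two points at a height `ℓ ∈ (-b, b)`: a third
one coincides with one of two distinct ones. [folklore] -/
theorem eq_or_eq_of_im_eq (ha : 0 < a) (hb : 0 < b) {p q z : ℂ} {ℓ : ℝ}
    (hp : p ∈ frontier (symRect a b)) (hq : q ∈ frontier (symRect a b))
    (hz : z ∈ frontier (symRect a b)) (hℓ1 : -b < ℓ) (hℓ2 : ℓ < b)
    (hpi : p.im = ℓ) (hqi : q.im = ℓ) (hzi : z.im = ℓ) (hpq : p ≠ q) : z = p ∨ z = q := by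
  have hp' := re_eq_of_mem_frontier ha hb hp (hpi ▸ hℓ1) (hpi ▸ hℓ2)
  have hq' := re_eq_of_mem_frontier ha hb hq (hqi ▸ hℓ1) (hqi ▸ hℓ2)
  have hz' := re_eq_of_mem_frontier ha hb hz (hzi ▸ hℓ1) (hzi ▸ hℓ2)
  have hre : p.re ≠ q.re := fun h => hpq (Complex.ext h (hpi.trans hqi.symm))
  rcases hz' with hz' | hz'
  · rcases hp' with hp' | hp'
    · exact Or.inl (Complex.ext (hz'.trans hp'.symm) (hzi.trans hpi.symm))
    · rcases hq' with hq' | hq'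
      · exact Or.inr (Complex.ext (hz'.trans hq'.symm) (hzi.trans hqi.symm))
      · exact absurd (hp'.trans hq'.symm) hre
  · rcases hp' with hp' | hp'
    · rcases hq' with hq' | hq'
      · exact absurd (hp'.trans hq'.symm) hre
      · exact Or.inr (Complex.ext (hz'.trans hq'.symm) (hzi.trans hqi.symm))
    · exact Or.inl (Complex.ext (hz'.trans hp'.symm) (hzi.trans hpi.symm))

section Loop

/-! ### A loop tracing the frontier of the rectangle, starting at a lateral point of height `-h` -/

variable {h : ℝ} {Ψ : ℝ → ℂ} {t₁ : ℝ}

/-- Points of the loop with parameter in `[0, 1)` are frontier points. [folklore] -/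
theorem mem_frontier_of_mem (hΨr : Ψ '' Ico 0 1 = frontier (symRect a b)) {t : ℝ}
    (ht : t ∈ Ico (0 : ℝ) 1) : Ψ t ∈ frontier (symRect a b) := by
  rw [← hΨr]; exact mem_image_of_mem Ψ ht

/-- Every frontier point has a parameter in `[0, 1)`. [folklore] -/
theorem exists_param (hΨr : Ψ '' Ico 0 1 = frontier (symRect a b)) {z : ℂ}
    (hz : z ∈ frontier (symRect a b)) : ∃ t ∈ Ico (0 : ℝ) 1, Ψ t = z := by
  rw [← hΨr] at hz; exact hz

/-- A parameter in `(0, 1)` other than `t₁` is not at height `-h`. [folklore] -/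
theorem im_ne_of_ne (ha : 0 < a) (hh : 0 < h) (hhb : h < b) (hΨi : InjOn Ψ (Ico 0 1))
    (hΨr : Ψ '' Ico 0 1 = frontier (symRect a b)) (h0 : (Ψ 0).im = -h)
    (ht₁ : t₁ ∈ Ioo (0 : ℝ) 1) (h1 : (Ψ t₁).im = -h)
    {t : ℝ} (ht : t ∈ Ioo (0 : ℝ) 1) (htne : t ≠ t₁) : (Ψ t).im ≠ -h := by
  intro hft
  have hb : 0 < b := hh.trans hhb
  have I0 : (0 : ℝ) ∈ Ico (0 : ℝ) 1 := ⟨le_rfl, zero_lt_one⟩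
  have I1 : t₁ ∈ Ico (0 : ℝ) 1 := ⟨ht₁.1.le, ht₁.2⟩
  have It : t ∈ Ico (0 : ℝ) 1 := ⟨ht.1.le, ht.2⟩
  have hne01 : Ψ 0 ≠ Ψ t₁ := fun e => (ne_of_lt ht₁.1) (hΨi I0 I1 e)
  rcases eq_or_eq_of_im_eq ha hb (mem_frontier_of_mem hΨr I0)
      (mem_frontier_of_mem hΨr I1)
      (mem_frontier_of_mem hΨr It)
      (by linarith) (by linarith) h0 h1 hft hne01 with e | e
  · exact (ne_of_gt ht.1) (hΨi It I0 e)
  · exact htne (hΨi It I1 e)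

/-- **Dichotomy of orientation.** One of the two open parameter arcs between `0` and `t₁` is
mapped strictly below the height `-h` (the other one passes over the top side). [folklore] -/
theorem forall_Ioo_im_lt_or (ha : 0 < a) (hh : 0 < h) (hhb : h < b) (hΨc : Continuous Ψ)
    (hΨi : InjOn Ψ (Ico 0 1)) (hΨr : Ψ '' Ico 0 1 = frontier (symRect a b))
    (h0 : (Ψ 0).im = -h) (ht₁ : t₁ ∈ Ioo (0 : ℝ) 1) (h1 : (Ψ t₁).im = -h) :
    (∀ t ∈ Ioo 0 t₁, (Ψ t).im < -h) ∨ (∀ t ∈ Ioo t₁ 1, (Ψ t).im < -h) := by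
  have hb : 0 < b := hh.trans hhb
  have hf : Continuous fun t => (Ψ t).im := Complex.continuous_im.comp hΨc
  have hA := forall_lt_or_forall_gt (f := fun t => (Ψ t).im) isPreconnected_Ioo hf.continuousOn
    (ℓ := -h) fun t ht => im_ne_of_ne ha hh hhb hΨi hΨr h0 ht₁ h1
      ⟨ht.1, ht.2.trans ht₁.2⟩ (ne_of_lt ht.2)
  have hB := forall_lt_or_forall_gt (f := fun t => (Ψ t).im) isPreconnected_Ioo hf.continuousOn
    (ℓ := -h) fun t ht => im_ne_of_ne ha hh hhb hΨi hΨr h0 ht₁ h1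
      ⟨ht₁.1.trans ht.1, ht.2⟩ (ne_of_gt ht.1)
  rcases hA with hA | hA
  · exact Or.inl hA
  rcases hB with hB | hB
  · exact Or.inr hB
  exfalso
  -- the bottom point `(0, -b)` is below `-h`, but both open arcs are above
  have hbot : (⟨0, -b⟩ : ℂ) ∈ frontier (symRect a b) :=
    (mem_frontier_symRect ha hb).2 (Or.inl ⟨⟨by simp; linarith, by simp; linarith⟩, Or.inl rfl⟩)
  obtain ⟨tb, htb, etb⟩ := exists_param hΨr hbot
  have hfb : (Ψ tb).im = -b := by rw [etb]
  have htb0 : tb ≠ 0 := by rintro rfl; rw [h0] at hfb; linarith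
  have htb1 : tb ≠ t₁ := by rintro rfl; rw [h1] at hfb; linarith
  rcases lt_or_gt_of_ne htb1 with hlt | hlt
  · have := hA tb ⟨lt_of_le_of_ne htb.1 (Ne.symm htb0), hlt⟩; linarith
  · have := hB tb ⟨hlt, htb.2⟩; linarith

/-- Under the orientation hypothesis "the arc `(0, t₁)` runs below `-h`", the complementary arc
`(t₁, 1)` runs strictly above `-h`. [folklore] -/
theorem forall_Ioo_lt_im (ha : 0 < a) (hh : 0 < h) (hhb : h < b) (hΨc : Continuous Ψ)
    (hΨi : InjOn Ψ (Ico 0 1)) (hΨr : Ψ '' Ico 0 1 = frontier (symRect a b))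
    (h0 : (Ψ 0).im = -h) (ht₁ : t₁ ∈ Ioo (0 : ℝ) 1) (h1 : (Ψ t₁).im = -h)
    (hor : ∀ t ∈ Ioo 0 t₁, (Ψ t).im < -h) :
    ∀ t ∈ Ioo t₁ 1, -h < (Ψ t).im := by
  have hb : 0 < b := hh.trans hhb
  have hf : Continuous fun t => (Ψ t).im := Complex.continuous_im.comp hΨc
  have hB := forall_lt_or_forall_gt (f := fun t => (Ψ t).im) isPreconnected_Ioo hf.continuousOn
    (ℓ := -h) fun t ht => im_ne_of_ne ha hh hhb hΨi hΨr h0 ht₁ h1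
      ⟨ht₁.1.trans ht.1, ht.2⟩ (ne_of_gt ht.1)
  rcases hB with hB | hB
  · exfalso
    -- the top point `(0, b)` is above `-h`
    have htop : (⟨0, b⟩ : ℂ) ∈ frontier (symRect a b) :=
      (mem_frontier_symRect ha hb).2 (Or.inl ⟨⟨by simp; linarith, by simp; linarith⟩, Or.inr rfl⟩)
    obtain ⟨tt, htt, ett⟩ := exists_param hΨr htop
    have hft : (Ψ tt).im = b := by rw [ett]
    have htt0 : tt ≠ 0 := by rintro rfl; rw [h0] at hft; linarith
    have htt1 : tt ≠ t₁ := by rintro rfl; rw [h1] at hft; linarith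
    rcases lt_or_gt_of_ne htt1 with hlt | hlt
    · have := hor tt ⟨lt_of_le_of_ne htt.1 (Ne.symm htt0), hlt⟩; linarith
    · have := hB tt ⟨hlt, htt.2⟩; linarith
  · exact hB

/-- Under the orientation hypothesis, the points at height `h` have parameters in `(t₁, 1)`.
[folklore] -/
theorem lt_of_im_eq (hh : 0 < h) (h0 : (Ψ 0).im = -h) (h1 : (Ψ t₁).im = -h) 
    (hor : ∀ t ∈ Ioo 0 t₁, (Ψ t).im < -h) {s : ℝ} (hs : s ∈ Ico (0 : ℝ) 1)
    (hsi : (Ψ s).im = h) : t₁ < s := by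
  have hs0 : s ≠ 0 := by rintro rfl; rw [h0] at hsi; linarith
  have hs1 : s ≠ t₁ := by rintro rfl; rw [h1] at hsi; linarith
  rcases lt_or_gt_of_ne hs1 with hlt | hlt
  · have := hor s ⟨lt_of_le_of_ne hs.1 (Ne.symm hs0), hlt⟩; linarith
  · exact hlt

/-- **Position of the four lateral points along the loop.** Under the orientation hypothesis,
if `u < v` in `(t₁, 1)` are the parameters of the two points at height `h`, then the closed arc
`[0, t₁]` stays at height `≤ -h`, the arc `[t₁, 1]` at height `≥ -h`, the arc `[u, v]` at height
`≥ h`, and the arcs `[0, u]`, `[v, 1]` at height `≤ h`. [folklore] -/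
theorem arcs_position (ha : 0 < a) (hh : 0 < h) (hhb : h < b) (hΨc : Continuous Ψ)
    (hΨ1 : Ψ 1 = Ψ 0) (hΨi : InjOn Ψ (Ico 0 1)) (hΨr : Ψ '' Ico 0 1 = frontier (symRect a b))
    (h0 : (Ψ 0).im = -h) (ht₁ : t₁ ∈ Ioo (0 : ℝ) 1) (h1 : (Ψ t₁).im = -h)
    (hor : ∀ t ∈ Ioo 0 t₁, (Ψ t).im < -h) {u v : ℝ} (hu : t₁ < u) (huv : u < v)
    (hv : v < 1) (hui : (Ψ u).im = h) (hvi : (Ψ v).im = h) :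
    (∀ t ∈ Icc 0 t₁, (Ψ t).im ≤ -h) ∧ (∀ t ∈ Icc t₁ 1, -h ≤ (Ψ t).im) ∧
      (∀ t ∈ Icc u v, h ≤ (Ψ t).im) ∧ (∀ t ∈ Icc 0 u, (Ψ t).im ≤ h) ∧
      (∀ t ∈ Icc v 1, (Ψ t).im ≤ h) := by
  have hb : 0 < b := hh.trans hhb
  have hf : Continuous fun t => (Ψ t).im := Complex.continuous_im.comp hΨc
  have hB := forall_Ioo_lt_im ha hh hhb hΨc hΨi hΨr h0 ht₁ h1 hor
  have hu0 : 0 < u := ht₁.1.trans hu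
  have Iu : u ∈ Ico (0 : ℝ) 1 := ⟨hu0.le, huv.trans hv⟩
  have Iv : v ∈ Ico (0 : ℝ) 1 := ⟨(hu0.trans huv).le, hv⟩
  have hne_uv : Ψ u ≠ Ψ v := fun e => (ne_of_lt huv) (hΨi Iu Iv e)
  -- the only parameters at height `h` are `u` and `v`
  have key : ∀ t ∈ Ioo (0 : ℝ) 1, (Ψ t).im = h → t = u ∨ t = v := by
    intro t ht hti
    have It : t ∈ Ico (0 : ℝ) 1 := ⟨ht.1.le, ht.2⟩
    rcases eq_or_eq_of_im_eq ha hb (mem_frontier_of_mem hΨr Iu)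
        (mem_frontier_of_mem hΨr Iv)
        (mem_frontier_of_mem hΨr It)
        (by linarith) hhb hui hvi hti hne_uv with e | e
    · exact Or.inl (hΨi It Iu e)
    · exact Or.inr (hΨi It Iv e)
  have P1 : ∀ t ∈ Icc 0 t₁, (Ψ t).im ≤ -h := by
    intro t ht
    rcases eq_or_lt_of_le ht.1 with e | hlt
    · rw [← e, h0]
    rcases eq_or_lt_of_le ht.2 with e | hlt'
    · rw [e, h1]
    exact (hor t ⟨hlt, hlt'⟩).le
  have P2 : ∀ t ∈ Icc t₁ 1, -h ≤ (Ψ t).im := by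
    intro t ht
    rcases eq_or_lt_of_le ht.1 with e | hlt
    · rw [← e, h1]
    rcases eq_or_lt_of_le ht.2 with e | hlt'
    · rw [e, hΨ1, h0]
    exact (hB t ⟨hlt, hlt'⟩).le
  -- the arc `(u, v)` is above `h`
  have P3 : ∀ t ∈ Icc u v, h ≤ (Ψ t).im := by
    have hside := forall_lt_or_forall_gt (f := fun t => (Ψ t).im) isPreconnected_Ioo
      hf.continuousOn (ℓ := h) (J := Ioo u v) fun t ht hti => by
        rcases key t ⟨hu0.trans ht.1, ht.2.trans hv⟩ hti with e | e
        · exact (ne_of_gt ht.1) e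
        · exact (ne_of_lt ht.2) e
    rcases hside with hlow | hhigh
    · exfalso
      -- then the arc runs along the lateral sides, from one side to the other: impossible
      have hlat : ∀ t ∈ Icc u v, (Ψ t).re ≠ 0 := by
        intro t ht
        have It : t ∈ Ico (0 : ℝ) 1 := ⟨(hu0.trans_le ht.1).le, ht.2.trans_lt hv⟩
        have hlo : -h ≤ (Ψ t).im := P2 t ⟨hu.le.trans ht.1, ht.2.trans hv.le⟩
        have hhi : (Ψ t).im ≤ h := by
          rcases eq_or_lt_of_le ht.1 with e | hlt
          · rw [← e, hui]
          rcases eq_or_lt_of_le ht.2 with e | hlt'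
          · rw [e, hvi]
          exact (hlow t ⟨hlt, hlt'⟩).le
        rcases re_eq_of_mem_frontier ha hb
            (mem_frontier_of_mem hΨr It)
            (by linarith) (by linarith) with e | e <;>
          · rw [e]; linarith
      have hre := forall_lt_or_forall_gt (f := fun t => (Ψ t).re) isPreconnected_Icc
        (Complex.continuous_re.comp hΨc).continuousOn (ℓ := 0) hlat
      have hur := re_eq_of_mem_frontier ha hb
        (mem_frontier_of_mem hΨr Iu) (by linarith) (by linarith)
      have hvr := re_eq_of_mem_frontier ha hb
        (mem_frontier_of_mem hΨr Iv) (by linarith) (by linarith)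
      have hre_ne : (Ψ u).re ≠ (Ψ v).re := fun e => hne_uv (Complex.ext e (hui.trans hvi.symm))
      have Ju : u ∈ Icc u v := left_mem_Icc.2 huv.le
      have Jv : v ∈ Icc u v := right_mem_Icc.2 huv.le
      rcases hre with hneg | hpos
      · rcases hur with e | e
        · rcases hvr with e' | e'
          · exact hre_ne (e.trans e'.symm)
          · have := hneg v Jv; linarith
        · have := hneg u Ju; linarith
      · rcases hur with e | e
        · have := hpos u Ju; linarith
        · rcases hvr with e' | e'
          · have := hpos v Jv; linarith
          · exact hre_ne (e.trans e'.symm)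
    · intro t ht
      rcases eq_or_lt_of_le ht.1 with e | hlt
      · rw [← e, hui]
      rcases eq_or_lt_of_le ht.2 with e | hlt'
      · rw [e, hvi]
      exact (hhigh t ⟨hlt, hlt'⟩).le
  -- the arc `[t₁, u)` is below `h`
  have P4 : ∀ t ∈ Icc 0 u, (Ψ t).im ≤ h := by
    have hside := forall_lt_or_forall_gt (f := fun t => (Ψ t).im) isPreconnected_Ico
      hf.continuousOn (ℓ := h) (J := Ico t₁ u) fun t ht hti => by
        rcases eq_or_lt_of_le ht.1 with e | hlt
        · rw [← e, h1] at hti; linarith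
        rcases key t ⟨ht₁.1.trans hlt, ht.2.trans (huv.trans hv)⟩ hti with e | e
        · exact (ne_of_lt ht.2) e
        · exact (ne_of_lt (ht.2.trans huv)) e
    have hlow : ∀ t ∈ Ico t₁ u, (Ψ t).im < h := by
      rcases hside with hlow | hhigh
      · exact hlow
      · have := hhigh t₁ ⟨le_rfl, hu⟩; linarith
    intro t ht
    rcases le_or_gt t t₁ with hle | hgt
    · exact (P1 t ⟨ht.1, hle⟩).trans (by linarith)
    rcases eq_or_lt_of_le ht.2 with e | hlt
    · rw [e, hui]
    exact (hlow t ⟨hgt.le, hlt⟩).le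
  -- the arc `(v, 1]` is below `h`
  have P5 : ∀ t ∈ Icc v 1, (Ψ t).im ≤ h := by
    have hside := forall_lt_or_forall_gt (f := fun t => (Ψ t).im) isPreconnected_Ioc
      hf.continuousOn (ℓ := h) (J := Ioc v 1) fun t ht hti => by
        rcases eq_or_lt_of_le ht.2 with e | hlt
        · rw [e, hΨ1, h0] at hti; linarith
        rcases key t ⟨(hu0.trans huv).trans ht.1, hlt⟩ hti with e | e
        · exact (ne_of_gt (huv.trans ht.1)) e
        · exact (ne_of_gt ht.1) e
    have hlow : ∀ t ∈ Ioc v 1, (Ψ t).im < h := by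
      rcases hside with hlow | hhigh
      · exact hlow
      · have := hhigh 1 ⟨hv, le_rfl⟩; rw [hΨ1, h0] at this; linarith
    intro t ht
    rcases eq_or_lt_of_le ht.1 with e | hlt
    · rw [← e, hvi]
    exact (hlow t ⟨hlt, ht.2⟩).le
  exact ⟨P1, P2, P3, P4, P5⟩

end Loop

end RectLoop

end Literature.Probability.RandomPlanarGeometry

end
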